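/-
Copyright (c) 2026. All rights reserved.
Released under Apache 2.0 license as described in the file LICENSE.
Authors: abc-iut cell, seat abc-iut-w5-d053 (gen 4; row «COR37-K2-SHIFT», the (R1) remainder of abc-iut-L4-t5's
DISCHARGE-PLAN-Cor37-compat.md).
-/
import Literature.AnabelianGeometry.AbsoluteAnabelian.AbsTopIII.BiAnabelianLogGlueFamily
import Literature.AnabelianGeometry.AbsoluteAnabelian.AbsTopIII.BiAnabelianCompatibilityGlueShift
import Literature.AnabelianGeometry.AbsoluteAnabelian.AbsTopIII.BiAnabelianNexusProofs
import Literature.AnabelianGeometry.AbsoluteAnabelian.DiagramShiftInvariance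
import HarnessLib

/-!
# [AbsTopIII] Cor 3.7 (v), final sentence — the nexus self-equivalences `Φ_m` are compatible with the glued family
# (cores of (i), (ii) + observable `𝔖†_log`)

S. Mochizuki, *Topics in absolute anabelian geometry III* [MochizukiAbsTopIII2015] (kurims manuscript
`paper:url-5493eb38cbb7`), Cor 3.7 (v) p. 88: "the self-equivalences in these nexus-classes are compatible with
`ℋ_δ` [cf. (ii)], as well as with the families of homotopies that constitute the cores, telecore, and observable
of (i), (ii), (iii)"; Def 3.5 (v) p. 76 (compatibility of a 1-morphism with families of homotopies: `Φ_Γ⃗` induces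
a bijection of the boundary sets and the homotopies commute with the `Φ_{[γ]}`).

PROOF-ONLY.  The glued family `K₂ = glueLogFamily hT hL` (`BiAnabelianLogGlueFamily.lean`) is INVARIANT under the
translation `Φ_m` of the first row (abc-iut-L4-t12's `shiftEquiv m`):
* boundary set: `GlueE` is stable under `Cor37Vertex.shift m` (`glueE_shift`; cells go to cells — type (1) at
  `⋎` to type (1) at `⋎ + m` by heterogeneous re-indexing of paths, abc-iut-w6-d023's device for Cor 3.6
  (`FrobeniusPictureMLFShiftLog`) — and `refCount` is shift-invariant), in both directions (`glueE_shift_iff`);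
* homotopies: `glueLogη (Φ_Γ⃗ P, Φ_Γ⃗ Q) ≍ glueLogη (P, Q)` (`glueLogη_shift_heq`: on pairs into `𝔈` abc-iut-L4-t5's
  `coresFamily_η_shift_heq`, p446226; elsewhere presentations shift to presentations with heterogeneously equal
  values, the categories at `⋎` and `⋎ + m` being equal);
whence, by abc-iut-w6-d023's `OneMorphism.nonempty_compatibleWith_of_invariant` exactly as in abc-iut-L4-t5's
`compatibleWith_shiftEquiv_glueFamily`, **`compatibleWith_shiftEquiv_glueLogFamily`** — the input `hKshift` of
abc-iut-L4-t5's `shiftCompatStmt'_of_glueFamily_le` (`BiAnabelianCompatibilityShiftAssembly.lean`).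

HONEST FRAMING: bookkeeping over the cell's typing of refereed pre-IUT material; (H×)/(Hlog) displayed, no `Prop`
fact; nothing here bears on [IUTchIII] Cor. 3.12; model-level ≠ node-level.
-/

set_option autoImplicit false

namespace Literature.AnabelianGeometry.AbsoluteAnabelian.AbsTopIII

open CategoryTheory Quiver
open Literature.AnabelianGeometry.AbsoluteAnabelian.DiagramOfCategories

universe w u

/-! ## Combinatorics: the translation on paths, cells and the boundary set -/

namespace StarGlue

section PathHEq

variable {W : Type*} [Quiver W]

/-- Extending heterogeneously equal paths by heterogeneously equal edges. [cite: MochizukiAbsTopIII2015, Section 0 p.26] -/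
theorem heq_cons {a b b' c : W} (hb : b = b') {p : Path a b} {p' : Path a b'} (hp : HEq p p')
    {e : b ⟶ c} {e' : b' ⟶ c} (he : HEq e e') : p.cons e = p'.cons e' := by
  subst hb; cases hp; cases he; rfl

end PathHEq

/-- Edges between first-row vertices are unique (only `log`, with a proof-irrelevant index identity).
[cite: MochizukiAbsTopIII2015, Cor 3.7 (ii) p.87] -/
theorem edge_first_first_heq {j j' k : ℤ} (hj : j = j') (e : Cor37Edge.{w} (.first j) (.first k))
    (e' : Cor37Edge.{w} (.first j') (.first k)) : HEq e e' := by
  subst hj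
  cases e with
  | log _ _ h =>
    cases e' with
    | log _ _ h' => rfl

/-- Edges from a first-row vertex to `□` are unique (`pr_⋎`). [cite: MochizukiAbsTopIII2015, Cor 3.7 (ii) p.87] -/
theorem edge_first_box_heq {j j' : ℤ} (hj : j = j') (e : Cor37Edge.{w} (.first j) .box)
    (e' : Cor37Edge.{w} (.first j') .box) : HEq e e' := by
  subst hj
  cases e with
  | pr _ =>
    cases e' with
    | pr _ => rfl

/-- The translation moves no vertex onto `ref` except `ref`. [cite: MochizukiAbsTopIII2015, Cor 3.7 (v) p.88] -/
theorem shiftObj_eq_ref_iff (m : ℤ) (c : Cor37Vertex) : Cor37Vertex.shiftObj m c = .ref ↔ c = .ref := by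
  cases c <;> simp [Cor37Vertex.shiftObj]

/-- `refCount` is invariant under the translation. [cite: MochizukiAbsTopIII2015, Cor 3.7 (v) p.88] -/
theorem refCount_shift (m : ℤ) {a : Cor37Vertex} :
    ∀ {b : Cor37Vertex} (P : StarPath.{w} a b), refCount ((Cor37Vertex.shift.{w, w} m).mapPath P) = refCount P
  | _, Path.nil => rfl
  | b, Path.cons P e => by
    rw [Prefunctor.mapPath_cons, refCount_cons, refCount_cons, refCount_shift m P]
    have hiff : (Cor37Vertex.shift.{w, w} m).obj b = Cor37Vertex.ref ↔ b = Cor37Vertex.ref :=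
      shiftObj_eq_ref_iff m b
    by_cases hb : b = Cor37Vertex.ref
    · rw [if_pos hb, if_pos (hiff.2 hb)]
    · rw [if_neg hb, if_neg (fun h => hb (hiff.1 h))]

/-- `VisitsRef` is invariant under the translation. [cite: MochizukiAbsTopIII2015, Cor 3.7 (v) p.88] -/
theorem visitsRef_shift_iff (m : ℤ) {a b : Cor37Vertex} (P : StarPath.{w} a b) :
    VisitsRef ((Cor37Vertex.shift.{w, w} m).mapPath P) ↔ VisitsRef P := by
  unfold VisitsRef
  rw [refCount_shift]
  exact or_congr (shiftObj_eq_ref_iff m a) Iff.rfl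

/-- **The translation maps cells to cells** (types (2), (3) behind the translated prefix; type (1) at `⋎` to
type (1) at `⋎ + m`, re-indexing `⋎ + 1 + m = ⋎ + m + 1`). [cite: MochizukiAbsTopIII2015, Cor 3.7 (v) p.88] -/
theorem exists_starCell_shift (m : ℤ) {x : Cor37Vertex} (g : StarCell.{w} x) :
    ∃ g' : StarCell.{w} (Cor37Vertex.shiftObj m x),
      g'.left = (Cor37Vertex.shift.{w, w} m).mapPath g.left ∧
        g'.right = (Cor37Vertex.shift.{w, w} m).mapPath g.right := by
  cases g with
  | refl r e =>
    exact ⟨StarCell.refl ((Cor37Vertex.shift.{w, w} m).mapPath r) (Cor37Vertex.shiftHom m e), rfl, rfl⟩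
  | times r => exact ⟨StarCell.times ((Cor37Vertex.shift.{w, w} m).mapPath r), rfl, rfl⟩
  | log n r =>
    -- re-index the translated prefix from `first (n + 1 + m)` to `first (n + m + 1)`
    have hv : Cor37Vertex.first (n + 1 + m) = Cor37Vertex.first (n + m + 1) := by rw [Int.add_right_comm]
    obtain ⟨r', hr'⟩ : ∃ r' : StarPath.{w} (Cor37Vertex.shiftObj m x) (Cor37Vertex.first (n + m + 1)),
        HEq r' ((Cor37Vertex.shift.{w, w} m).mapPath r) := by
      have : ∀ {b b' : Cor37Vertex} (e : b = b') (s : StarPath.{w} (Cor37Vertex.shiftObj m x) b),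
          ∃ s' : StarPath.{w} (Cor37Vertex.shiftObj m x) b', HEq s' s := by
        intro b b' e s; subst e; exact ⟨s, HEq.rfl⟩
      exact this hv _
    refine ⟨StarCell.log (n + m) r', ?_, ?_⟩
    · show ((r'.cons _).cons _).cons _ = ((((Cor37Vertex.shift.{w, w} m).mapPath r).cons _).cons _).cons _
      have h1 : r'.cons (Cor37Edge.log (n + m + 1) (n + m) rfl) =
          ((Cor37Vertex.shift.{w, w} m).mapPath r).cons
            ((Cor37Vertex.shift.{w, w} m).map (Cor37Edge.log (n + 1) n rfl)) :=
        heq_cons hv.symm hr' (edge_first_first_heq (by rw [Int.add_right_comm]) _ _)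
      rw [h1]
      rfl
    · show (r'.cons _).cons _ = ((((Cor37Vertex.shift.{w, w} m).mapPath r).cons _)).cons _
      have h1 : r'.cons (Cor37Edge.pr (n + m + 1)) =
          ((Cor37Vertex.shift.{w, w} m).mapPath r).cons
            ((Cor37Vertex.shift.{w, w} m).map (Cor37Edge.pr (n + 1))) :=
        heq_cons hv.symm hr' (edge_first_box_heq (by rw [Int.add_right_comm]) _ _)
      rw [h1]
      rfl

/-- **The boundary set `GlueE` is stable under the translation.** [cite: MochizukiAbsTopIII2015, Cor 3.7 (v) p.88] -/
theorem glueE_shift (m : ℤ) {a b : Cor37Vertex} {P Q : StarPath.{w} a b} (h : GlueE P Q) :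
    GlueE ((Cor37Vertex.shift.{w, w} m).mapPath P) ((Cor37Vertex.shift.{w, w} m).mapPath Q) := by
  cases h with
  | rfl P => exact GlueE.rfl _
  | gal P R => exact GlueE.gal _ _
  | cell g hg =>
    obtain ⟨g', hl, hr⟩ := exists_starCell_shift m g
    rw [← hl, ← hr]
    exact GlueE.cell g' (fun hv => hg ((visitsRef_shift_iff m g.left).1 (hl ▸ hv)))
  | tailEq p q t ht =>
    rw [Prefunctor.mapPath_comp, Prefunctor.mapPath_comp]
    exact GlueE.tailEq _ _ _ ((refCount_shift m t).trans ht)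
  | tailCell p q g hg =>
    obtain ⟨g', hl, hr⟩ := exists_starCell_shift m g
    rw [Prefunctor.mapPath_comp, Prefunctor.mapPath_comp, ← hl, ← hr]
    exact GlueE.tailCell _ _ g' (hl ▸ (refCount_shift m g.left).trans hg)

/-- `Φ_Γ⃗` induces a bijection of `GlueE` (both translations `±m`). [cite: MochizukiAbsTopIII2015, Cor 3.7 (v) p.88] -/
theorem glueE_shift_iff (m : ℤ) {a b : Cor37Vertex} (P Q : StarPath.{u} a b) :
    GlueE P Q ↔ GlueE ((Cor37Vertex.shift.{u, u} m).mapPath P) ((Cor37Vertex.shift.{u, u} m).mapPath Q) :=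
  HomotopyFamily.E_mapPath_iff_of_inverse (Cor37Vertex.shift_comp_neg m) GlueE.{u}
    (fun _ _ _ _ h => glueE_shift m h) (fun _ _ _ _ h => glueE_shift (-m) h) P Q

end StarGlue

/-! ## The homotopies are invariant under the translation -/

namespace BiAnabelianSetting

open StarGlue

variable {X E N : Type u} [Category.{u} X] [Category.{u} E] [Category.{u} N]
  (𝔖 : BiAnabelianSetting X E N)

/-! ### Heterogeneous bookkeeping across the (propositionally) equal categories at `⋎` and `⋎ + m` -/

section HEqAcross

variable {A A' B B' C : Type u} [iA : Category.{u} A] [iA' : Category.{u} A'] [iB : Category.{u} B]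
  [iB' : Category.{u} B'] [Category.{u} C]

/-- `eqToHom`s between heterogeneously equal functors are heterogeneously equal (categories varying along
propositional equalities; abc-iut-L4-t5's device). [cite: MochizukiAbsTopIII2015, Definition 3.5 (ii) p.75] -/
theorem eqToHom_heq_eqToHom_across (hA : A = A') (hiA : HEq iA iA') (hB : B = B') (hiB : HEq iB iB')
    {P Q : A ⥤ B} {P' Q' : A' ⥤ B'} (hP : HEq P P') (hQ : HEq Q Q') (e : P = Q) (e' : P' = Q') :
    HEq (eqToHom e) (eqToHom e') := by
  subst hA; subst hB; cases hiA; cases hiB; cases hP; cases hQ; rfl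

/-- Left whiskering respects heterogeneous equality, the source category varying.
[cite: MochizukiAbsTopIII2015, Definition 3.5 (ii) p.75] -/
theorem whiskerLeft_heq_across (hA : A = A') (hiA : HEq iA iA') {R : A ⥤ B} {R' : A' ⥤ B} (hR : HEq R R')
    {F G F' G' : B ⥤ C} (hF : F = F') (hG : G = G') {α : F ⟶ G} {α' : F' ⟶ G'} (h : HEq α α') :
    HEq (Functor.whiskerLeft R α) (Functor.whiskerLeft R' α') := by
  subst hA; cases hiA; cases hR; subst hF hG; cases h; rfl

/-- Identities of heterogeneously equal functors, the source category varying.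
[cite: MochizukiAbsTopIII2015, Definition 3.5 (ii) p.75] -/
theorem id_heq_id_across (hA : A = A') (hiA : HEq iA iA') {F : A ⥤ B} {F' : A' ⥤ B} (h : HEq F F') :
    HEq (𝟙 F) (𝟙 F') := by
  subst hA; cases hiA; cases h; rfl

end HEqAcross

/-- The categories at `a` and at `Φ_Γ⃗ a` are the same type. [cite: MochizukiAbsTopIII2015, Cor 3.7 (v) p.88] -/
theorem obj_shift (m : ℤ) (a : Cor37Vertex) :
    𝔖.starDiagram.obj ((Cor37Vertex.shift.{u, u} m).obj a) = 𝔖.starDiagram.obj a :=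
  𝔖.starDiagram.obj_eq_of_comapAlong_eq _ (𝔖.comapAlong_shift m) a

/-- ... with the same category structure. [cite: MochizukiAbsTopIII2015, Cor 3.7 (v) p.88] -/
theorem cat_shift_heq (m : ℤ) (a : Cor37Vertex) :
    HEq (𝔖.starDiagram.cat ((Cor37Vertex.shift.{u, u} m).obj a)) (𝔖.starDiagram.cat a) :=
  𝔖.starDiagram.cat_heq_of_comapAlong_eq _ (𝔖.comapAlong_shift m) a

/-- The structural path functor of a translated path is (heterogeneously) that of the path.
[cite: MochizukiAbsTopIII2015, Cor 3.7 (v) p.88] -/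
theorem pathFunctor'_shift_heq (m : ℤ) {a b : Cor37Vertex} (P : StarPath.{u} a b) :
    HEq (𝔖.starDiagram.pathFunctor' ((Cor37Vertex.shift.{u, u} m).mapPath P)) (𝔖.starDiagram.pathFunctor' P) := by
  rw [← pathFunctor_eq_pathFunctor', ← pathFunctor_eq_pathFunctor']
  exact 𝔖.starDiagram.pathFunctor_mapPath_heq _ (𝔖.comapAlong_shift m) P

/-- Structural path functors of heterogeneously equal paths (equal sources) agree.
[cite: MochizukiAbsTopIII2015, Definition 3.5 (i) p.75] -/
theorem pathFunctor'_heq_of_heq {a b b' : Cor37Vertex} (e : b = b') {P : StarPath.{u} a b} {P' : StarPath.{u} a b'}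
    (h : HEq P P') : HEq (𝔖.starDiagram.pathFunctor' P) (𝔖.starDiagram.pathFunctor' P') := by
  subst e; cases h; rfl

/-- **The translation maps cells to cells WITH THE SAME CELL HOMOTOPY** (heterogeneously).
[cite: MochizukiAbsTopIII2015, Cor 3.7 (v) p.88] -/
theorem exists_starCell_shift_cellη (m : ℤ) {x : Cor37Vertex} (g : StarCell.{u} x) :
    ∃ g' : StarCell.{u} (Cor37Vertex.shiftObj m x),
      g'.left = (Cor37Vertex.shift.{u, u} m).mapPath g.left ∧
        g'.right = (Cor37Vertex.shift.{u, u} m).mapPath g.right ∧ HEq (𝔖.cellη g') (𝔖.cellη g) := by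
  cases g with
  | refl r e =>
    refine ⟨StarCell.refl ((Cor37Vertex.shift.{u, u} m).mapPath r) (Cor37Vertex.shiftHom m e), rfl, rfl, ?_⟩
    exact id_heq_id_across (𝔖.obj_shift m x) (𝔖.cat_shift_heq m x) (𝔖.pathFunctor'_shift_heq m (r.cons e))
  | times r =>
    refine ⟨StarCell.times ((Cor37Vertex.shift.{u, u} m).mapPath r), rfl, rfl, ?_⟩
    exact whiskerLeft_heq_across (𝔖.obj_shift m x) (𝔖.cat_shift_heq m x) (𝔖.pathFunctor'_shift_heq m r)
      rfl rfl HEq.rfl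
  | log n r =>
    have hv : Cor37Vertex.first (n + 1 + m) = Cor37Vertex.first (n + m + 1) := by rw [Int.add_right_comm]
    obtain ⟨r', hr'⟩ : ∃ r' : StarPath.{u} (Cor37Vertex.shiftObj m x) (Cor37Vertex.first (n + m + 1)),
        HEq r' ((Cor37Vertex.shift.{u, u} m).mapPath r) := by
      have : ∀ {b b' : Cor37Vertex} (e : b = b') (s : StarPath.{u} (Cor37Vertex.shiftObj m x) b),
          ∃ s' : StarPath.{u} (Cor37Vertex.shiftObj m x) b', HEq s' s := by
        intro b b' e s; subst e; exact ⟨s, HEq.rfl⟩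
      exact this hv _
    refine ⟨StarCell.log (n + m) r', ?_, ?_, ?_⟩
    · show ((r'.cons _).cons _).cons _ = ((((Cor37Vertex.shift.{u, u} m).mapPath r).cons _).cons _).cons _
      have h1 : r'.cons (Cor37Edge.log (n + m + 1) (n + m) rfl) =
          ((Cor37Vertex.shift.{u, u} m).mapPath r).cons
            ((Cor37Vertex.shift.{u, u} m).map (Cor37Edge.log (n + 1) n rfl)) :=
        heq_cons hv.symm hr' (edge_first_first_heq (by rw [Int.add_right_comm]) _ _)
      rw [h1]
      rfl
    · show (r'.cons _).cons _ = ((((Cor37Vertex.shift.{u, u} m).mapPath r).cons _)).cons _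
      have h1 : r'.cons (Cor37Edge.pr (n + m + 1)) =
          ((Cor37Vertex.shift.{u, u} m).mapPath r).cons
            ((Cor37Vertex.shift.{u, u} m).map (Cor37Edge.pr (n + 1))) :=
        heq_cons hv.symm hr' (edge_first_box_heq (by rw [Int.add_right_comm]) _ _)
      rw [h1]
      rfl
    · exact whiskerLeft_heq_across (𝔖.obj_shift m x) (𝔖.cat_shift_heq m x)
        ((𝔖.pathFunctor'_heq_of_heq hv.symm hr').trans (𝔖.pathFunctor'_shift_heq m r)) rfl rfl HEq.rfl

/-- **Presentations shift to presentations with (heterogeneously) the same homotopy.**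
[cite: MochizukiAbsTopIII2015, Cor 3.7 (v) p.88] -/
theorem exists_glueDec_shift (m : ℤ) {a b : Cor37Vertex} {P Q : StarPath.{u} a b} (d : GlueDec P Q) :
    ∃ d' : GlueDec ((Cor37Vertex.shift.{u, u} m).mapPath P) ((Cor37Vertex.shift.{u, u} m).mapPath Q),
      HEq (d'.val 𝔖) (d.val 𝔖) := by
  cases d with
  | rfl h =>
    subst h
    refine ⟨GlueDec.rfl rfl, ?_⟩
    rw [val_rfl, val_rfl]
    exact eqToHom_heq_eqToHom_across (𝔖.obj_shift m a) (𝔖.cat_shift_heq m a) (𝔖.obj_shift m b)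
      (𝔖.cat_shift_heq m b) (𝔖.pathFunctor'_shift_heq m P) (𝔖.pathFunctor'_shift_heq m P) _ _
  | reroute p q t ht hP hQ =>
    subst hP hQ
    refine ⟨GlueDec.reroute ((Cor37Vertex.shift.{u, u} m).mapPath p) ((Cor37Vertex.shift.{u, u} m).mapPath q)
      ((Cor37Vertex.shift.{u, u} m).mapPath t) ((refCount_shift m t).trans ht)
      (Prefunctor.mapPath_comp _ _ _) (Prefunctor.mapPath_comp _ _ _), ?_⟩
    rw [val_reroute, val_reroute]
    exact eqToHom_heq_eqToHom_across (𝔖.obj_shift m a) (𝔖.cat_shift_heq m a) (𝔖.obj_shift m b)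
      (𝔖.cat_shift_heq m b) (𝔖.pathFunctor'_shift_heq m _) (𝔖.pathFunctor'_shift_heq m _) _ _
  | cell g hg hP hQ =>
    subst hP hQ
    obtain ⟨g', hl, hr, hη⟩ := 𝔖.exists_starCell_shift_cellη m g
    refine ⟨GlueDec.cell g' (fun hv => hg ((visitsRef_shift_iff m g.left).1 (hl ▸ hv))) hl.symm hr.symm, ?_⟩
    exact (𝔖.val_cell_heq g' _ hl.symm hr.symm).trans (hη.trans (𝔖.val_cell_heq g hg rfl rfl).symm)
  | tailCell p q g hg hP hQ =>
    subst hP hQ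
    obtain ⟨g', hl, hr, hη⟩ := 𝔖.exists_starCell_shift_cellη m g
    refine ⟨GlueDec.tailCell ((Cor37Vertex.shift.{u, u} m).mapPath p) ((Cor37Vertex.shift.{u, u} m).mapPath q) g'
      (hl ▸ (refCount_shift m g.left).trans hg) (by rw [Prefunctor.mapPath_comp, ← hl]; rfl)
      (by rw [Prefunctor.mapPath_comp, ← hr]; rfl),
      ?_⟩
    refine (𝔖.val_tailCell_heq _ _ g' _ _ _).trans (HEq.trans ?_ (𝔖.val_tailCell_heq p q g hg rfl rfl).symm)
    exact whiskerLeft_heq_across (𝔖.obj_shift m a) (𝔖.cat_shift_heq m a) (𝔖.pathFunctor'_shift_heq m q)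
      (eq_of_heq ((𝔖.pathFunctor'_heq_of_heq rfl (heq_of_eq hl)).trans (𝔖.pathFunctor'_shift_heq m g.left)))
      (eq_of_heq ((𝔖.pathFunctor'_heq_of_heq rfl (heq_of_eq hr)).trans (𝔖.pathFunctor'_shift_heq m g.right)))
      hη

section Family

variable (hT : ∀ y : X, 𝔖.spaceGal.map (𝔖.iotaTimes.app y) = 𝔖.lamTimesGal.hom.app y ≫ 𝔖.lamTimesPfGal.inv.app y)
  (hL : ∀ A : X, 𝔖.spaceGal.map (𝔖.iotaLog.app A) =
    𝔖.lamTimesGal.hom.app (𝔖.log.obj A) ≫ 𝔖.logGal.hom.app A ≫ 𝔖.lamTimesPfGal.inv.app A)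

/-- **The glued homotopies are invariant under the translation**: `glueLogη (Φ_Γ⃗ P, Φ_Γ⃗ Q) ≍ glueLogη (P, Q)`.
[cite: MochizukiAbsTopIII2015, Cor 3.7 (v) p.88] -/
theorem glueLogη_shift_heq (m : ℤ) {a b : Cor37Vertex} {P Q : StarPath.{u} a b} (h : GlueE P Q)
    (h' : GlueE ((Cor37Vertex.shift.{u, u} m).mapPath P) ((Cor37Vertex.shift.{u, u} m).mapPath Q)) :
    HEq (𝔖.glueLogη h') (𝔖.glueLogη h) := by
  by_cases hb : b = Cor37Vertex.galois
  · subst hb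
    have hK : 𝔖.coresFamily.E P Q := (𝔖.coresFamily_E_iff P Q).2 rfl
    have hK' := 𝔖.coresFamily_E_shift m hK
    exact (𝔖.glueLogη_heq_of_galois h' hK').trans
      ((𝔖.coresFamily_η_shift_heq m hK hK').trans (𝔖.glueLogη_heq_of_galois h hK).symm)
  · have hb' : (Cor37Vertex.shift.{u, u} m).obj b ≠ Cor37Vertex.galois :=
      fun e => hb ((shiftObj_eq_galois_iff m b).1 e)
    obtain ⟨d⟩ := nonempty_glueDec h hb
    obtain ⟨d', hd'⟩ := 𝔖.exists_glueDec_shift m d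
    rw [𝔖.glueLogη_eq_val h hb d, 𝔖.glueLogη_eq_val h' hb' d']
    exact hd'

/-- The homotopies of the glued family are invariant under the translation.
[cite: MochizukiAbsTopIII2015, Cor 3.7 (v) p.88] -/
theorem glueLogFamily_η_shift_heq (m : ℤ) {a b : Cor37Vertex} {P Q : StarPath.{u} a b}
    (h : (𝔖.glueLogFamily hT hL).E P Q)
    (h' : (𝔖.glueLogFamily hT hL).E ((Cor37Vertex.shift.{u, u} m).mapPath P)
      ((Cor37Vertex.shift.{u, u} m).mapPath Q)) :
    HEq ((𝔖.glueLogFamily hT hL).η h') ((𝔖.glueLogFamily hT hL).η h) := by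
  rw [glueLogFamily_η, glueLogFamily_η]
  exact (HomotopyFamily.heq_eqToHom_comp_comp_eqToHom _ _ _).trans
    ((𝔖.glueLogη_shift_heq m h h').trans (HomotopyFamily.heq_eqToHom_comp_comp_eqToHom _ _ _).symm)

/-- **[AbsTopIII] Cor 3.7 (v), final sentence — cores AND observable part, under `ι` over Galois**: the nexus
self-equivalence `Φ_m` (abc-iut-L4-t12's `shiftEquiv m`) is compatible, in the sense of Def 3.5 (v), with the
glued family realising the cores of (i), (ii) and the observable `𝔖†_log` of (iii) — the input `hKshift` of
abc-iut-L4-t5's `shiftCompatStmt'_of_glueFamily_le`. [cite: MochizukiAbsTopIII2015, Cor 3.7 (v) p.88] -/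
theorem compatibleWith_shiftEquiv_glueLogFamily (m : ℤ) :
    Nonempty ((𝔖.shiftEquiv m).hom.CompatibleWith (𝔖.glueLogFamily hT hL) (𝔖.glueLogFamily hT hL)) :=
  OneMorphism.nonempty_compatibleWith_of_invariant (𝔖.shiftMor m) (𝔖.comapAlong_shift m)
    (𝔖.shiftApp_heq_id m) (𝔖.shiftMor_iso_app m)
    (fun _ _ p' => Prefunctor.exists_mapPath_eq_of_inverse (Cor37Vertex.shift_comp_neg m)
      (Cor37Vertex.shift_neg_comp m) p')
    (𝔖.glueLogFamily hT hL) (𝔖.glueLogFamily hT hL) (fun _ _ P Q => glueE_shift_iff m P Q)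
    (fun _ _ _ _ h => 𝔖.glueLogFamily_η_shift_heq hT hL m h _)

end Family

end BiAnabelianSetting

end Literature.AnabelianGeometry.AbsoluteAnabelian.AbsTopIII
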